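import Literature.Combinatorics.SimpleGraph.GraphAbelJacobi
import Mathlib.Combinatorics.SimpleGraph.Connectivity.EdgeConnectivity
import Mathlib.Data.Set.Card
import HarnessLib

/-!
# Edge cuts and `k`-edge-connectivity («`G` is `k`-edge-connected iff every cut has size at least
# `k`»), and Baker–Norine's Theorem 1.8 with Mathlib's `IsEdgeConnected`
# (Baker–Norine 2007, §1.2, Theorem 1.8)

Source (held, read at the page; statements VERBATIM). M. Baker, S. Norine, *Riemann–Roch and
Abel–Jacobi theory on a finite graph*, Adv. Math. 215 (2007) 766–788 [BakerNorine2007], §1.2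
(held text `paper:doi-10-1016-j-aim-2007-04-012` p. 2): «For `k ≥ 2`, a graph `G` is called
`k`-edge-connected if `G − W` is connected for every set `W` of at most `k − 1` edges of `G`. (By
convention, we consider the trivial graph having one vertex and no edges to be `k`-edge-connected
for all `k`.) Alternatively, define a cut to be the set of all edges connecting a vertex in `V₁`
to a vertex in `V₂` for some partition of `V(G)` into disjoint non-empty subsets `V₁` and `V₂`.
Then `G` is `k`-edge-connected if and only if every cut has size at least `k`.» §1.4, §4.3:
«**Theorem 1.8.** The map `S^{(k)}` is injective if and only if `G` is `(k+1)`-edge-connected.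
[…] In particular, `S` is injective if and only if every edge of `G` is contained in a cycle.»

## What is formalised

Mathlib's `G.IsEdgeConnected k` («any two vertices remain reachable after removing strictly fewer
than `k` edges») is B–N's first definition; this file proves the equivalence with the cut form and
restates Theorem 1.8 (proved in cut form in `GraphAbelJacobi`) with it.

* `cutEdges G A` — the cut determined by the vertex set `A` (the edges with exactly one end in
  `A`), `mem_cutEdges_iff`, **`card_cutEdges`** (its size is `Σ_{v∈A} outdeg_A(v)`);
* **`isEdgeConnected_iff_forall_le_card_cutEdges`** («`G` is `k`-edge-connected if and only if
  every cut has size at least `k`»; any finite simple graph) and the `outdeg` form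
  `isEdgeConnected_iff_forall_le_sum`;
* **Theorem 1.8** `abelJacobi_injective_iff_isEdgeConnected` (`S^{(k)}` injective iff
  `G.IsEdgeConnected (k + 1)`, `G` connected), and the case `k = 1`:
  `eq_single_of_nonneg_of_sum_eq_one` (`Div₊¹(G) = V(G)`),
  **`linEquiv_single_imp_eq_iff_isEdgeConnected_two`** («`S` is injective if and only if» `G` is
  `2`-edge-connected, i.e. `(v) ∼ (w) ⇒ v = w`).

Definitions with bodies and theorems; no `sorry`; no named facts.
-/

open Finset SimpleGraph Matrix
open Literature.Combinatorics.SimpleGraph.ChipFiring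

namespace Literature.Combinatorics.SimpleGraph.BakerNorine

variable {V : Type*} [Fintype V] [DecidableEq V] (G : SimpleGraph V) [DecidableRel G.Adj]

/-! ### §1 The cut determined by a vertex set -/

section Cut

/-- The **cut** determined by `A`: «the set of all edges connecting a vertex in `V₁` to a vertex
in `V₂`» for the partition `V₁ = A`, `V₂ = V(G) − A`. [cite: BakerNorine2007, §1.2] -/
def cutEdges (A : Finset V) : Finset (Sym2 V) :=
  A.biUnion fun x => (G.neighborFinset x \ A).image fun y => s(x, y)

/-- Membership in the cut: the edges `xy` with `x ∈ A`, `y ∉ A`. [cite: BakerNorine2007, §1.2] -/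
theorem mem_cutEdges_iff {A : Finset V} {e : Sym2 V} :
    e ∈ cutEdges G A ↔ ∃ x ∈ A, ∃ y, y ∉ A ∧ G.Adj x y ∧ e = s(x, y) := by
  simp only [cutEdges, Finset.mem_biUnion, Finset.mem_image, Finset.mem_sdiff, mem_neighborFinset]
  constructor
  · rintro ⟨x, hx, y, ⟨hxy, hy⟩, rfl⟩
    exact ⟨x, hx, y, hy, hxy, rfl⟩
  · rintro ⟨x, hx, y, hy, hxy, rfl⟩
    exact ⟨x, hx, y, ⟨hxy, hy⟩, rfl⟩

/-- **The size of the cut of `A` is `Σ_{v∈A} outdeg_A(v)`** («`Σ_{v∈A} outdeg_A(v)` is equal to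
the size of the edge cut between `A` and `V(G) − A`»).
[cite: BakerNorine2007, Theorem 1.8 (proof)] -/
theorem card_cutEdges (A : Finset V) : #(cutEdges G A) = ∑ x ∈ A, #(G.neighborFinset x \ A) := by
  rw [cutEdges, Finset.card_biUnion]
  · refine Finset.sum_congr rfl fun x _ => Finset.card_image_of_injOn ?_
    intro y _ y' _ h
    exact Sym2.congr_right.1 h
  · intro x hx x' hx' hne
    change Disjoint _ _
    rw [Finset.disjoint_left]
    intro e he he'
    rw [Finset.mem_image] at he he'
    obtain ⟨y, hy, rfl⟩ := he
    obtain ⟨y', -, h⟩ := he'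
    rw [Sym2.eq_iff] at h
    rcases h with ⟨h1, -⟩ | ⟨h1, -⟩
    · exact hne h1.symm
    · exact (Finset.mem_sdiff.1 hy).2 (h1 ▸ Finset.mem_coe.1 hx')

end Cut

/-! ### §2 `k`-edge-connectivity via cuts -/

section EdgeConnected

/-- **«`G` is `k`-edge-connected if and only if every cut has size at least `k`»** — Mathlib's
`IsEdgeConnected k` (B–N's «`G − W` is connected for every set `W` of at most `k − 1` edges»)
against the cut form. [cite: BakerNorine2007, §1.2] -/
theorem isEdgeConnected_iff_forall_le_card_cutEdges (k : ℕ) :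
    G.IsEdgeConnected k ↔ ∀ A : Finset V, A.Nonempty → Aᶜ.Nonempty → k ≤ #(cutEdges G A) := by
  constructor
  · rintro h A ⟨a, ha⟩ ⟨b, hb⟩
    by_contra hlt
    push Not at hlt
    have hb' : b ∉ A := Finset.mem_compl.1 hb
    -- delete the whole cut: fewer than `k` edges, yet `a` and `b` get disconnected
    have hab := h a b
    rw [SimpleGraph.IsEdgeReachable] at hab
    have hreach := hab (s := (cutEdges G A : Set (Sym2 V)))
      (by rw [Set.encard_coe_eq_coe_finsetCard]; exact_mod_cast hlt)
    obtain ⟨p⟩ := hreach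
    obtain ⟨d, -, hd1, hd2⟩ := p.exists_boundary_dart (A : Set V) (Finset.mem_coe.2 ha)
      (fun h' => hb' (Finset.mem_coe.1 h'))
    have hadj := d.adj
    rw [SimpleGraph.deleteEdges_adj] at hadj
    refine hadj.2 (Finset.mem_coe.2 ((mem_cutEdges_iff G).2 ?_))
    exact ⟨d.fst, Finset.mem_coe.1 hd1, d.snd, fun h' => hd2 (Finset.mem_coe.2 h'), hadj.1, rfl⟩
  · intro h
    rw [SimpleGraph.IsEdgeConnected]
    intro u v
    rw [SimpleGraph.IsEdgeReachable]
    intro s hs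
    classical
    by_contra hreach
    have hfin : s.Finite := Set.encard_lt_top_iff.1 (hs.trans_le le_top)
    -- `A` = the vertices reachable from `u` after deleting `s`; its cut lies inside `s`
    set A : Finset V := univ.filter (fun w => (G.deleteEdges s).Reachable u w) with hA
    have huA : u ∈ A := by simp [hA]
    have hvA : v ∉ A := by simpa [hA] using hreach
    have hcut : cutEdges G A ⊆ hfin.toFinset := by
      intro e he
      rw [mem_cutEdges_iff] at he
      obtain ⟨x, hx, y, hy, hxy, rfl⟩ := he
      rw [Set.Finite.mem_toFinset]
      by_contra hes
      have hxy' : (G.deleteEdges s).Adj x y := (SimpleGraph.deleteEdges_adj).2 ⟨hxy, hes⟩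
      have hux : (G.deleteEdges s).Reachable u x := (Finset.mem_filter.1 hx).2
      exact hy (Finset.mem_filter.2 ⟨mem_univ y, hux.trans hxy'.reachable⟩)
    have h1 := h A ⟨u, huA⟩ ⟨v, Finset.mem_compl.2 hvA⟩
    have h2 := Finset.card_le_card hcut
    have h3 : ((hfin.toFinset.card : ℕ) : ℕ∞) = s.encard := (hfin.encard_eq_coe_toFinset_card).symm
    have h4 : (k : ℕ∞) ≤ hfin.toFinset.card := by exact_mod_cast h1.trans h2
    rw [h3] at h4
    exact (not_lt.2 h4) hs

/-- The cut form with `outdeg`: `G` is `k`-edge-connected iff `Σ_{v∈A} outdeg_A(v) ≥ k` for every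
non-empty proper vertex set `A`. [cite: BakerNorine2007, §1.2 and Theorem 1.8 (proof)] -/
theorem isEdgeConnected_iff_forall_le_sum (k : ℕ) :
    G.IsEdgeConnected k ↔
      ∀ A : Finset V, A.Nonempty → Aᶜ.Nonempty → k ≤ ∑ x ∈ A, #(G.neighborFinset x \ A) := by
  simp only [isEdgeConnected_iff_forall_le_card_cutEdges, card_cutEdges]

end EdgeConnected

/-! ### §3 Theorem 1.8 with `IsEdgeConnected` -/

section AbelJacobi

variable {G}

/-- **Theorem 1.8.** «The map `S^{(k)}` is injective if and only if `G` is `(k+1)`-edge-connected»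
(`G` connected; Mathlib's `IsEdgeConnected`). [cite: BakerNorine2007, Theorem 1.8] -/
theorem abelJacobi_injective_iff_isEdgeConnected (hG : G.Connected) (v₀ : V) (k : ℕ) :
    Function.Injective (abelJacobi G v₀ k) ↔ G.IsEdgeConnected (k + 1) := by
  rw [abelJacobi_injective_iff_forall_cut hG, isEdgeConnected_iff_forall_le_sum]
  refine forall_congr' fun A => forall_congr' fun _ => forall_congr' fun _ => ?_
  rw [← Nat.cast_sum]
  norm_cast

/-- `Div₊¹(G) = V(G)`: an effective divisor of degree `1` is a single vertex `(v)` («The set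
`Div₊¹(G)` is canonically isomorphic to `V(G)`»). [cite: BakerNorine2007, §1.3] -/
theorem eq_single_of_nonneg_of_sum_eq_one {D : V → ℤ} (hD : 0 ≤ D) (hs : ∑ v, D v = 1) :
    ∃ v, D = Pi.single v 1 := by
  -- some vertex carries a dollar; it carries exactly one and the others none
  obtain ⟨v, -, hv⟩ : ∃ v ∈ (univ : Finset V), 0 < D v := by
    by_contra hcon
    push Not at hcon
    have : ∑ v, D v ≤ 0 := Finset.sum_nonpos hcon
    omega
  refine ⟨v, funext fun w => ?_⟩
  have hrest : ∑ u ∈ univ.erase v, D u = 1 - D v := by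
    rw [← Finset.add_sum_erase _ _ (mem_univ v)] at hs
    omega
  have hnn : 0 ≤ ∑ u ∈ univ.erase v, D u := Finset.sum_nonneg fun u _ => hD u
  by_cases hw : w = v
  · subst hw
    rw [Pi.single_eq_same]
    omega
  · rw [Pi.single_eq_of_ne hw]
    have h1 : (0 : ℤ) ≤ D w := hD w
    have h2 : D w ≤ ∑ u ∈ univ.erase v, D u :=
      Finset.single_le_sum (fun u _ => hD u) (Finset.mem_erase.2 ⟨hw, mem_univ w⟩)
    omega

/-- **Theorem 1.8 for `k = 1`.** «`S` is injective if and only if» `G` is `2`-edge-connected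
(«every edge of `G` is contained in a cycle»): `(v) ∼ (w)` only for `v = w`.
[cite: BakerNorine2007, Theorem 1.8 and §4.3] -/
theorem linEquiv_single_imp_eq_iff_isEdgeConnected_two (hG : G.Connected) :
    (∀ v w : V, LinEquiv G (Pi.single v 1) (Pi.single w 1) → v = w) ↔ G.IsEdgeConnected 2 := by
  obtain ⟨v₀⟩ := hG.nonempty
  rw [← abelJacobi_injective_iff_isEdgeConnected hG v₀ 1, abelJacobi_injective_iff]
  have hsingle : ∀ v : V, (0 : V → ℤ) ≤ Pi.single v 1 ∧ ∑ u, Pi.single v (1 : ℤ) u = (1 : ℕ) :=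
    fun v => ⟨fun u => by
      by_cases hu : u = v
      · subst hu
        simp
      · simp [hu], by rw [Finset.sum_pi_single', if_pos (mem_univ v)]; rfl⟩
  constructor
  · intro h D D' hD hD' hs hs' hDD'
    obtain ⟨v, rfl⟩ := eq_single_of_nonneg_of_sum_eq_one hD (by exact_mod_cast hs)
    obtain ⟨w, rfl⟩ := eq_single_of_nonneg_of_sum_eq_one hD' (by exact_mod_cast hs')
    rw [h v w hDD']
  · intro h v w hvw
    have := h _ _ (hsingle v).1 (hsingle w).1 (hsingle v).2 (hsingle w).2 hvw
    by_contra hne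
    have h1 := congrFun this v
    rw [Pi.single_eq_same, Pi.single_eq_of_ne hne] at h1
    exact one_ne_zero h1

end AbelJacobi

end Literature.Combinatorics.SimpleGraph.BakerNorine
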